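import Literature.Combinatorics.SimpleGraph.ListTreeDecomposition
import Mathlib.Algebra.BigOperators.Group.Finset.Basic
import Mathlib.Algebra.Order.BigOperators.Group.Finset
import Mathlib.Data.Finset.Card
import Mathlib.Data.Finset.Max
import Mathlib.Data.Fin.VecNotation
import HarnessLib

/-!
# Balanced separators from a rooted tree decomposition (Robertson–Seymour, list form)

Topic `Literature/Combinatorics/SimpleGraph`, sequel of `ListTreeDecomposition.lean`. The existence
half of the Robertson–Seymour approximation of treewidth (Cygan et al., *Parameterized Algorithms*,
Lemma 7.19: "if `tw(G) ≤ k`, every `W ⊆ V(G)` has a balanced separator of size `≤ k + 1`", namely a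
bag; Lemma 7.20 / Cor. 7.21: hence a separation `(A, B)` of order `≤ k + 1` with
`|W ∩ A|, |W ∩ B| ≤ ⅔|W|`), for rooted decompositions in list form and a graph given by a symmetric
edge relation `E` on natural numbers:

* `mem_below_of_adj` — the bag of the parent of `c` separates the vertices below `c` from the
  rest: a neighbour of a vertex below `c` and outside `bag (parent c)` is below `c`
  (Cygan et al., Lemma 7.3); `exists_bag_of_pairwise_covered` — the Helly property: pairwise
  covered vertices (e.g. a clique) lie in one bag;
* the parts at a node `t`: `kids` (the children of `t`), the vertices strictly below a child
  (`below c ∖ bag t`), the vertices above (`S ∖ below t`); `parts_cover`, `parts_disjoint`,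
  `mem_part_of_adj` (no edge joins two different parts);
* `exists_twoThirds_split` — weights each at most half the total split into two groups each at
  most two thirds (the grouping step of Lemma 7.20);
* **`exists_balanced_labeling`**: for a rooted decomposition of `S` covering the edges of `E`
  inside `S`, all bags of size `≤ k + 1`, and `W ⊆ S`, there is a labeling `ℓ : ℕ → Fin 3`
  (`0` = side `A`, `1` = separator, `2` = side `B`) with no edge of `S` from label `0` to label
  `2`, at most `k + 1` vertices of `S` labeled `1`, and at most `⅔|W|` vertices of `W` on either
  side. The separator is the bag of the LAST node `t` (in index order, i.e. a deepest one) below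
  which more than half of `W` occurs: every child subtree then carries at most half of `W`, and
  so does the outside.

This is the input to the completeness of the treewidth-approximation procedure of
`TreewidthApproximation.lean` (it tries all labelings of a padded bag `W` and finds the cheapest
compatible separator by dynamic programming).

## References

* M. Cygan, F. V. Fomin, Ł. Kowalik, D. Lokshtanov, D. Marx, M. Pilipczuk, M. Pilipczuk,
  S. Saurabh, *Parameterized Algorithms*, Springer 2015, §7.2 (Lemma 7.3), §7.6.1 (Lemma 7.19,
  Lemma 7.20, Corollary 7.21).
* N. Robertson, P. D. Seymour, *Graph minors. XIII. The disjoint paths problem*, J. Combin. Theory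
  Ser. B 63 (1995) 65–110 (the approximation of treewidth via balanced separators; cited by
  Markov–Shi, Thm. 4.3, as [RSX]).
-/

namespace Literature.Combinatorics.SimpleGraph

namespace ListTD

open Finset

variable {S : Finset ℕ} {par : List ℕ} {bags : List (List ℕ)} {E : ℕ → ℕ → Prop}

/-! ### Bags separate what is below them -/

/-- **(T2) on `S`**: every edge of `E` inside `S` lies in a bag. [cite: MarkovShi2008, §2 ((T2))] -/
def CoversEdges (S : Finset ℕ) (E : ℕ → ℕ → Prop) (bags : List (List ℕ)) : Prop :=
  ∀ u ∈ S, ∀ v ∈ S, E u v → ∃ t, t < bags.length ∧ u ∈ bagOf bags t ∧ v ∈ bagOf bags t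

/-- Covering the edges is preserved by restriction to a subset of the vertices. [folklore] -/
theorem CoversEdges.induce {S S' : Finset ℕ} (h : CoversEdges S E bags) (hS' : S' ⊆ S) :
    CoversEdges S' E (bags.map fun B => B.filter fun v => decide (v ∈ S')) := by
  intro u hu v hv huv
  obtain ⟨t, ht, hut, hvt⟩ := h u (hS' hu) v (hS' hv) huv
  refine ⟨t, by simpa using ht, ?_, ?_⟩ <;> rw [bagOf_map_filter] <;> simp [hut, hvt, hu, hv]

/-- **The parent bag of `c` separates the vertices below `c` from the rest** (Cygan et al.,
Lemma 7.3, rooted form): a neighbour in `S` of a vertex below `c` not lying in `bag (parent c)` is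
below `c`. [cite: CyganEtAl2015, Lemma 7.3] -/
theorem mem_below_of_adj (hD : IsRootedTDOn S par bags) (hT2 : CoversEdges S E bags) {c u v : ℕ}
    (hu : u ∈ below par bags c) (hux : u ∉ bagOf bags (pr par c)) (hv : v ∈ S) (huv : E u v) :
    v ∈ below par bags c := by
  obtain ⟨s, hs, hcs, hus⟩ := mem_below.1 hu
  obtain ⟨r, hr, hur, hvr⟩ := hT2 u (hD.bag_mem s u hus) v hv huv
  by_cases hcr : IsAnc par c r
  · exact mem_below.2 ⟨r, hr, hcr, hvr⟩
  · exact absurd (mem_bagOf_pr_of_mem_of_not_below hD hs hus hcs hr hur hcr) hux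

/-- **Helly property of rooted tree decompositions**: vertices pairwise covered by bags are all
in one bag — the first bag, of largest index, of one of them. (So every clique of a covered graph,
e.g. the scope of a factor of a network, lies in a bag.) [cite: CyganEtAl2015, §7.2 (every clique is contained in a bag)] -/
theorem exists_bag_of_pairwise_covered (hD : IsRootedTDOn S par bags) (K : List ℕ)
    (hK : ∀ u ∈ K, ∀ v ∈ K, ∃ t, t < bags.length ∧ u ∈ bagOf bags t ∧ v ∈ bagOf bags t) :
    ∃ t, t < bags.length ∧ ∀ v ∈ K, v ∈ bagOf bags t := by
  classical
  by_cases hne : K = []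
  · subst hne; exact ⟨0, hD.pos, fun v hv => by simp at hv⟩
  · -- a vertex of `K` whose first bag has the largest index
    obtain ⟨v₁, hv₁, hmax⟩ : ∃ v₁ ∈ K, ∀ v ∈ K, firstBag bags v ≤ firstBag bags v₁ := by
      obtain ⟨v₁, hv₁, hmax⟩ := Finset.exists_max_image K.toFinset (firstBag bags)
        (by obtain ⟨x, hx⟩ := List.exists_mem_of_ne_nil K hne; exact ⟨x, List.mem_toFinset.2 hx⟩)
      exact ⟨v₁, List.mem_toFinset.1 hv₁, fun v hv => hmax v (List.mem_toFinset.2 hv)⟩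
    obtain ⟨t₁, ht₁, hv₁t, -⟩ := hK v₁ hv₁ v₁ hv₁
    have hf₁ := firstBag_spec ⟨t₁, ht₁, hv₁t⟩
    refine ⟨firstBag bags v₁, hf₁.1, fun v hv => ?_⟩
    obtain ⟨r, hr, hv₁r, hvr⟩ := hK v₁ hv₁ v hv
    have ha₁ : IsAnc par (firstBag bags v₁) r := isAnc_firstBag hD hr hv₁r
    have ha : IsAnc par (firstBag bags v) r := isAnc_firstBag hD hr hvr
    -- the first bag of `v` is an ancestor of the first bag of `v₁`
    have hanc : IsAnc par (firstBag bags v) (firstBag bags v₁) := by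
      rcases isAnc_total ha ha₁ with h | h
      · exact h
      · have hle : firstBag bags v₁ ≤ firstBag bags v := h.le hD
        have hge : firstBag bags v ≤ firstBag bags v₁ := hmax v hv
        rw [le_antisymm hle hge]
        exact isAnc_refl par _
    exact mem_bagOf_of_isAnc hD hr hvr ha₁ hanc

/-! ### The parts at a node -/

/-- **The children of `t`** among the bag indices. [folklore] -/
def kids (par : List ℕ) (bags : List (List ℕ)) (t : ℕ) : List ℕ :=
  (List.range bags.length).filter fun c => decide (c ≠ 0 ∧ pr par c = t)

/-- Membership in `kids`. [folklore] -/
theorem mem_kids {t c : ℕ} : c ∈ kids par bags t ↔ c < bags.length ∧ c ≠ 0 ∧ pr par c = t := by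
  simp [kids]

/-- `kids` has no repetition. [folklore] -/
theorem nodup_kids (t : ℕ) : (kids par bags t).Nodup := (List.nodup_range).filter _

/-- **The part strictly below the child `c` of `t`**: the vertices below `c` outside `bag t`.
[cite: CyganEtAl2015, §7.6.1 (proof of Lemma 7.19: the components below the children)] -/
noncomputable def partBelow (par : List ℕ) (bags : List (List ℕ)) (t c : ℕ) : Finset ℕ :=
  below par bags c \ (bagOf bags t).toFinset

/-- **The part above `t`**: the vertices of `S` not below `t`. [cite: CyganEtAl2015, §7.6.1 (proof of Lemma 7.19: the rest of the graph)] -/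
noncomputable def partAbove (S : Finset ℕ) (par : List ℕ) (bags : List (List ℕ)) (t : ℕ) : Finset ℕ :=
  S \ below par bags t

/-- **The list of parts at `t`**: the part above, then the parts below the children.
[cite: CyganEtAl2015, §7.6.1 (proof of Lemma 7.19)] -/
noncomputable def parts (S : Finset ℕ) (par : List ℕ) (bags : List (List ℕ)) (t : ℕ) : List (Finset ℕ) :=
  partAbove S par bags t :: (kids par bags t).map (partBelow par bags t)

/-- **The parts cover `S` outside `bag t`.** [cite: CyganEtAl2015, §7.6.1] -/
theorem parts_cover (hD : IsRootedTDOn S par bags) {t v : ℕ} (hv : v ∈ S) (hvt : v ∉ bagOf bags t) :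
    ∃ p ∈ parts S par bags t, v ∈ p := by
  by_cases hb : v ∈ below par bags t
  · obtain ⟨c, hc0, -, hpc, hvc⟩ := exists_child_of_mem_below hb hvt
    obtain ⟨s, hs, hcs, -⟩ := mem_below.1 hvc
    have hck : c ∈ kids par bags t := mem_kids.2 ⟨(hcs.le hD).trans_lt hs, hc0, hpc⟩
    refine ⟨partBelow par bags t c, List.mem_cons_of_mem _ (List.mem_map_of_mem hck), ?_⟩
    exact Finset.mem_sdiff.2 ⟨hvc, by simpa using hvt⟩
  · exact ⟨partAbove S par bags t, List.mem_cons_self, Finset.mem_sdiff.2 ⟨hv, hb⟩⟩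

/-- Parts avoid `bag t`. [folklore] -/
theorem not_mem_bagOf_of_mem_part {t v : ℕ} (ht : t < bags.length)
    {p : Finset ℕ} (hp : p ∈ parts S par bags t) (hv : v ∈ p) : v ∉ bagOf bags t := by
  rcases List.mem_cons.1 hp with rfl | hp
  · exact fun hvt => (Finset.mem_sdiff.1 hv).2 (mem_below_self ht hvt)
  · obtain ⟨c, -, rfl⟩ := List.mem_map.1 hp
    simpa using (Finset.mem_sdiff.1 hv).2

/-- Parts consist of vertices of `S`. [folklore] -/
theorem subset_of_mem_parts (hD : IsRootedTDOn S par bags) {t : ℕ} {p : Finset ℕ} (hp : p ∈ parts S par bags t) :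
    p ⊆ S := by
  rcases List.mem_cons.1 hp with rfl | hp
  · exact Finset.sdiff_subset
  · obtain ⟨c, -, rfl⟩ := List.mem_map.1 hp
    exact Finset.sdiff_subset.trans (below_subset hD c)

/-- **Distinct parts are disjoint** (by index in the list of parts). [cite: CyganEtAl2015, Lemma 7.3] -/
theorem parts_disjoint (hD : IsRootedTDOn S par bags) {t i j : ℕ} (hi : i < (parts S par bags t).length)
    (hj : j < (parts S par bags t).length) (hij : i ≠ j) :
    Disjoint ((parts S par bags t)[i]) ((parts S par bags t)[j]) := by
  -- reduce to: above vs below, and below two distinct children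
  have key1 : ∀ c, Disjoint (partAbove S par bags t) (partBelow par bags t c) ∨ ¬ (pr par c = t) := by
    intro c
    by_cases hc : pr par c = t
    · left
      rw [Finset.disjoint_left]
      intro v hv hv'
      have hbt : below par bags c ⊆ below par bags t := below_subset_of_isAnc (hc ▸ isAnc_pr par c)
      exact (Finset.mem_sdiff.1 hv).2 (hbt (Finset.mem_sdiff.1 hv').1)
    · exact Or.inr hc
  have key2 : ∀ c c', c ∈ kids par bags t → c' ∈ kids par bags t → c ≠ c' →
      Disjoint (partBelow par bags t c) (partBelow par bags t c') := by
    intro c c' hc hc' hcc'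
    obtain ⟨-, hc0, hpc⟩ := mem_kids.1 hc
    obtain ⟨-, hc'0, hpc'⟩ := mem_kids.1 hc'
    rw [Finset.disjoint_left]
    intro v hv hv'
    have := mem_bagOf_of_below_of_below hD hc0 hc'0 hcc' hpc hpc' (Finset.mem_sdiff.1 hv).1
      (Finset.mem_sdiff.1 hv').1
    exact (Finset.mem_sdiff.1 hv).2 (by simpa using this)
  -- case analysis on the indices
  unfold parts at hi hj ⊢
  cases i with
  | zero =>
    cases j with
    | zero => exact absurd rfl hij
    | succ j =>
      simp only [List.length_cons, Nat.succ_lt_succ_iff, List.length_map] at hj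
      simp only [List.getElem_cons_zero, List.getElem_cons_succ, List.getElem_map]
      have hc := mem_kids.1 (List.getElem_mem hj)
      exact (key1 _).resolve_right (not_not.2 hc.2.2)
  | succ i =>
    simp only [List.length_cons, Nat.succ_lt_succ_iff, List.length_map] at hi
    cases j with
    | zero =>
      simp only [List.getElem_cons_zero, List.getElem_cons_succ, List.getElem_map]
      have hc := mem_kids.1 (List.getElem_mem hi)
      exact ((key1 _).resolve_right (not_not.2 hc.2.2)).symm
    | succ j =>
      simp only [List.length_cons, Nat.succ_lt_succ_iff, List.length_map] at hj
      simp only [List.getElem_cons_succ, List.getElem_map]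
      refine key2 _ _ (List.getElem_mem hi) (List.getElem_mem hj) fun h => hij ?_
      rw [(nodup_kids (par := par) (bags := bags) t).getElem_inj_iff] at h
      rw [h]

/-- **No edge leaves a part except into `bag t`**: a neighbour in `S` of a vertex of a part lies in
the same part or in `bag t`. [cite: CyganEtAl2015, Lemma 7.3] -/
theorem mem_part_of_adj (hD : IsRootedTDOn S par bags) (hE : ∀ u v, E u v → E v u) (hT2 : CoversEdges S E bags)
    {t : ℕ} {p : Finset ℕ} (hp : p ∈ parts S par bags t) {u v : ℕ} (hu : u ∈ p)
    (hv : v ∈ S) (huv : E u v) (hvt : v ∉ bagOf bags t) : v ∈ p := by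
  rcases List.mem_cons.1 hp with rfl | hp'
  · -- `u` above: if `v` were below `t`, it would be in a child part, whose neighbours are below
    refine Finset.mem_sdiff.2 ⟨hv, fun hvb => ?_⟩
    obtain ⟨c, hc0, -, hpc, hvc⟩ := exists_child_of_mem_below hvb hvt
    have hub : u ∈ below par bags c :=
      mem_below_of_adj hD hT2 hvc (by rwa [hpc]) (Finset.mem_sdiff.1 hu).1 (hE _ _ huv)
    exact (Finset.mem_sdiff.1 hu).2 (below_subset_of_isAnc (hpc ▸ isAnc_pr par c) hub)
  · obtain ⟨c, hc, rfl⟩ := List.mem_map.1 hp'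
    obtain ⟨-, -, hpc⟩ := mem_kids.1 hc
    refine Finset.mem_sdiff.2 ⟨?_, by simpa using hvt⟩
    exact mem_below_of_adj hD hT2 (Finset.mem_sdiff.1 hu).1
      (by rw [hpc]; simpa using (Finset.mem_sdiff.1 hu).2) hv huv

/-! ### Splitting weights two-thirds / two-thirds -/

/-- **Grouping**: weights indexed by `{0, …, len-1}`, each at most half of `N` and summing to at
most `N`, split into two groups each of weight at most two thirds of `N` (a heaviest weight alone,
or the shortest prefix reaching a third, or everything). [cite: CyganEtAl2015, Lemma 7.20 (proof: grouping the components)] -/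
theorem exists_twoThirds_split (w : ℕ → ℕ) (len N : ℕ) (h2 : ∀ i, i < len → 2 * w i ≤ N)
    (hs : ∑ i ∈ Finset.range len, w i ≤ N) :
    ∃ I ⊆ Finset.range len, 3 * ∑ i ∈ I, w i ≤ 2 * N ∧ 3 * ∑ i ∈ Finset.range len \ I, w i ≤ 2 * N := by
  classical
  by_cases hex : ∃ i, i < len ∧ N ≤ 3 * w i
  · obtain ⟨i, hi, hiN⟩ := hex
    have hsub : ({i} : Finset ℕ) ⊆ Finset.range len := by simpa using hi
    refine ⟨{i}, hsub, ?_, ?_⟩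
    · have := h2 i hi; rw [Finset.sum_singleton]; omega
    · have hsplit := Finset.sum_sdiff (f := w) hsub
      rw [Finset.sum_singleton] at hsplit
      omega
  · have hex' : ∀ i, i < len → 3 * w i < N := fun i hi => by
      by_contra hc; exact hex ⟨i, hi, not_lt.1 hc⟩
    -- prefix sums
    by_cases hall : 3 * ∑ i ∈ Finset.range len, w i < N
    · refine ⟨Finset.range len, subset_rfl, by omega, by simp⟩
    · have hP : ∃ n, n ≤ len ∧ N ≤ 3 * ∑ i ∈ Finset.range n, w i := ⟨len, le_rfl, not_lt.1 hall⟩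
      obtain ⟨n₀, ⟨hn₀le, hn₀N⟩, hn₀min⟩ : ∃ n₀, (n₀ ≤ len ∧ N ≤ 3 * ∑ i ∈ Finset.range n₀, w i) ∧
          ∀ m, m < n₀ → ¬ (m ≤ len ∧ N ≤ 3 * ∑ i ∈ Finset.range m, w i) :=
        ⟨Nat.find hP, Nat.find_spec hP, fun m hm => Nat.find_min hP hm⟩
      have hsub : Finset.range n₀ ⊆ Finset.range len := Finset.range_subset_range.2 hn₀le
      have hsplit := Finset.sum_sdiff (f := w) hsub
      refine ⟨Finset.range n₀, hsub, ?_, by omega⟩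
      rcases Nat.eq_zero_or_pos n₀ with h0 | hpos
      · simp [h0]
      · obtain ⟨m, hm⟩ := Nat.exists_eq_succ_of_ne_zero hpos.ne'
        have hlt : ¬ (m ≤ len ∧ N ≤ 3 * ∑ i ∈ Finset.range m, w i) := hn₀min m (by omega)
        have hmN : 3 * ∑ i ∈ Finset.range m, w i < N := by
          by_contra hc; exact hlt ⟨by omega, not_lt.1 hc⟩
        rw [hm, Finset.sum_range_succ]
        have := hex' m (by omega)
        omega

/-! ### The balanced labeling -/

/-- **Robertson–Seymour's balanced separator, as a labeling** (Cygan et al., Lemma 7.19 with the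
grouping of Lemma 7.20, rooted list form): given a rooted tree decomposition of `S` covering the
edges of the symmetric relation `E` inside `S`, with all bags of size `≤ k + 1`, and `W ⊆ S`, there
is `ℓ : ℕ → Fin 3` with no edge inside `S` from a vertex labeled `0` to a vertex labeled `2`, at most
`k + 1` vertices of `S` labeled `1` (they form a bag), and at most `⅔ |W|` vertices of `W` labeled
`0`, likewise `2`. [cite: CyganEtAl2015, Lemma 7.19, Lemma 7.20 and Corollary 7.21] -/
theorem exists_balanced_labeling (hD : IsRootedTDOn S par bags) (hE : ∀ u v, E u v → E v u)
    (hT2 : CoversEdges S E bags) {k : ℕ} (hk : ∀ t, t < bags.length → (bagOf bags t).length ≤ k + 1)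
    {W : Finset ℕ} (hW : W ⊆ S) :
    ∃ ℓ : ℕ → Fin 3,
      (∀ u ∈ S, ∀ v ∈ S, E u v → ℓ u = 0 → ℓ v ≠ 2) ∧
      (S.filter fun v => ℓ v = 1).card ≤ k + 1 ∧
      3 * (W.filter fun v => ℓ v = 0).card ≤ 2 * W.card ∧
      3 * (W.filter fun v => ℓ v = 2).card ≤ 2 * W.card := by
  classical
  -- the empty `W`: label everything `2`
  rcases W.eq_empty_or_nonempty with rfl | hWne
  · exact ⟨fun _ => 2, fun u _ v _ _ h => by simp at h, by simp, by simp, by simp⟩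
  -- the last node below which more than half of `W` occurs
  set T : Finset ℕ := (Finset.range bags.length).filter fun t => W.card < 2 * (W ∩ below par bags t).card
    with hT
  have h0T : 0 ∈ T := by
    refine Finset.mem_filter.2 ⟨Finset.mem_range.2 hD.pos, ?_⟩
    rw [below_zero hD, Finset.inter_eq_left.2 hW]
    have := hWne.card_pos; omega
  set t := T.max' ⟨0, h0T⟩ with ht
  have htT : t ∈ T := Finset.max'_mem T ⟨0, h0T⟩
  obtain ⟨htlen, htW⟩ : t < bags.length ∧ W.card < 2 * (W ∩ below par bags t).card := by
    simpa [hT] using htT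
  have hmax : ∀ c, t < c → c < bags.length → 2 * (W ∩ below par bags c).card ≤ W.card := by
    intro c htc hc
    by_contra hcon
    have hcT : c ∈ T := Finset.mem_filter.2 ⟨Finset.mem_range.2 hc, by omega⟩
    have := Finset.le_max' T c hcT
    rw [← ht] at this
    omega
  -- the parts at `t` and their weights
  set ps := parts S par bags t with hps
  set w : ℕ → ℕ := fun i => (W ∩ ps.getD i ∅).card with hw
  have hgetD : ∀ (i : ℕ) (hi : i < ps.length), ps.getD i ∅ = ps[i] := fun i hi => by
    rw [List.getD_eq_getElem?_getD, List.getElem?_eq_getElem hi]; rfl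
  -- each part carries at most half of `W`
  have h2 : ∀ i, i < ps.length → 2 * w i ≤ W.card := by
    intro i hi
    simp only [hw, hgetD i hi]
    cases i with
    | zero =>
      -- the part above: `W ∖ below t`
      have heq : W ∩ ps[0] = W \ (W ∩ below par bags t) := by
        simp only [hps, parts, List.getElem_cons_zero, partAbove]
        ext v; simp only [Finset.mem_inter, Finset.mem_sdiff]; constructor
        · rintro ⟨hv, -, hnb⟩; exact ⟨hv, fun h => hnb h.2⟩
        · rintro ⟨hv, h⟩; exact ⟨hv, hW hv, fun hb => h ⟨hv, hb⟩⟩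
      rw [heq, Finset.card_sdiff_of_subset Finset.inter_subset_left]
      omega
    | succ i =>
      have hi' : i < (kids par bags t).length := by
        simpa [hps, parts] using hi
      have hget : ps[i + 1] = partBelow par bags t ((kids par bags t)[i]) := by
        simp [hps, parts]
      obtain ⟨hclen, hc0, hpc⟩ := mem_kids.1 (List.getElem_mem hi')
      have htc : t < (kids par bags t)[i] := by
        have := pr_lt hD hc0; rw [hpc] at this; exact this
      refine le_trans ?_ (hmax _ htc hclen)
      rw [hget]
      exact Nat.mul_le_mul_left 2 (Finset.card_le_card (Finset.inter_subset_inter_left Finset.sdiff_subset))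
  -- the parts are disjoint, so their weights sum to at most `|W|`
  have hs : ∑ i ∈ Finset.range ps.length, w i ≤ W.card := by
    have hdisj : Set.PairwiseDisjoint (↑(Finset.range ps.length) : Set ℕ) fun i => W ∩ ps.getD i ∅ := by
      intro i hi j hj hij
      have hi' := Finset.mem_range.1 hi
      have hj' := Finset.mem_range.1 hj
      simp only [Function.onFun, hgetD i hi', hgetD j hj']
      exact (parts_disjoint hD hi' hj' hij).mono Finset.inter_subset_right Finset.inter_subset_right
    rw [← Finset.card_biUnion hdisj]
    exact Finset.card_le_card (Finset.biUnion_subset.2 fun i _ => Finset.inter_subset_left)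
  obtain ⟨I, hI, hI0, hI2⟩ := exists_twoThirds_split w ps.length W.card h2 hs
  -- the labeling
  set P : ℕ → Prop := fun v => ∃ i ∈ I, v ∈ ps.getD i ∅ with hP
  let ℓ : ℕ → Fin 3 := fun v => if v ∈ bagOf bags t then 1 else if P v then 0 else 2
  have hℓ1 : ∀ v, ℓ v = 1 ↔ v ∈ bagOf bags t := by
    intro v; simp only [ℓ]
    by_cases h1 : v ∈ bagOf bags t
    · simp [h1]
    · by_cases h2 : P v
      · simp [h1, h2]
      · simp [h1, h2]
  have hℓ0 : ∀ v, ℓ v = 0 ↔ v ∉ bagOf bags t ∧ P v := by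
    intro v; simp only [ℓ]
    by_cases h1 : v ∈ bagOf bags t
    · simp [h1]
    · by_cases h2 : P v
      · simp [h1, h2]
      · simp [h1, h2]
  have hℓ2 : ∀ v, ℓ v = 2 ↔ v ∉ bagOf bags t ∧ ¬ P v := by
    intro v; simp only [ℓ]
    by_cases h1 : v ∈ bagOf bags t
    · simp [h1]
    · by_cases h2 : P v
      · simp [h1, h2]
      · simp [h1, h2]
  refine ⟨ℓ, ?_, ?_, ?_, ?_⟩
  · -- no edge from label `0` to label `2`
    intro u hu v hv huv hu0 hv2
    obtain ⟨-, i, hiI, hui⟩ := (hℓ0 u).1 hu0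
    obtain ⟨hvt, hvno⟩ := (hℓ2 v).1 hv2
    have hi : i < ps.length := Finset.mem_range.1 (hI hiI)
    rw [hgetD i hi] at hui
    have hvi : v ∈ ps[i] := mem_part_of_adj hD hE hT2 (List.getElem_mem hi) hui hv huv hvt
    exact hvno ⟨i, hiI, by rwa [hgetD i hi]⟩
  · -- the separator is `bag t`
    calc (S.filter fun v => ℓ v = 1).card ≤ (bagOf bags t).toFinset.card := by
          refine Finset.card_le_card fun v hv => ?_
          rw [Finset.mem_filter] at hv
          simpa using (hℓ1 v).1 hv.2
      _ ≤ (bagOf bags t).length := List.toFinset_card_le _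
      _ ≤ k + 1 := hk t htlen
  · -- side `0`: inside the selected parts
    have hsub : (W.filter fun v => ℓ v = 0) ⊆ I.biUnion fun i => W ∩ ps.getD i ∅ := by
      intro v hv
      obtain ⟨hvW, hv0⟩ := Finset.mem_filter.1 hv
      obtain ⟨-, i, hiI, hvi⟩ := (hℓ0 v).1 hv0
      exact Finset.mem_biUnion.2 ⟨i, hiI, Finset.mem_inter.2 ⟨hvW, hvi⟩⟩
    calc 3 * (W.filter fun v => ℓ v = 0).card ≤ 3 * ∑ i ∈ I, w i :=
          Nat.mul_le_mul_left 3 ((Finset.card_le_card hsub).trans Finset.card_biUnion_le)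
      _ ≤ 2 * W.card := hI0
  · -- side `2`: inside the unselected parts
    have hsub : (W.filter fun v => ℓ v = 2) ⊆ (Finset.range ps.length \ I).biUnion fun i => W ∩ ps.getD i ∅ := by
      intro v hv
      obtain ⟨hvW, hv2⟩ := Finset.mem_filter.1 hv
      obtain ⟨hvt, hvno⟩ := (hℓ2 v).1 hv2
      obtain ⟨p, hp, hvp⟩ := parts_cover hD (hW hvW) hvt
      obtain ⟨i, hi, rfl⟩ := List.mem_iff_getElem.1 hp
      refine Finset.mem_biUnion.2 ⟨i, Finset.mem_sdiff.2 ⟨Finset.mem_range.2 hi, fun hiI => hvno ⟨i, hiI, ?_⟩⟩,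
        Finset.mem_inter.2 ⟨hvW, ?_⟩⟩ <;> rwa [hgetD i hi]
    calc 3 * (W.filter fun v => ℓ v = 2).card ≤ 3 * ∑ i ∈ Finset.range ps.length \ I, w i :=
          Nat.mul_le_mul_left 3 ((Finset.card_le_card hsub).trans Finset.card_biUnion_le)
      _ ≤ 2 * W.card := hI2

end ListTD

end Literature.Combinatorics.SimpleGraph
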